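import Summits.BirchSwinnertonDyer.BirchSwinnertonDyer.Theorems.PrintCFramBottomClassIndexLawFiveLeFlipRungCutIndex
import Summits.BirchSwinnertonDyer.BirchSwinnertonDyer.Theorems.PrintCFramBottomClassIndexLawFiveLeFlipRungCutReading
import HarnessLib

/-!
# Crux `PrintCFram.BottomClassIndexLawFiveLe` (stmt-BirchSwinnertonDyer-20372), line `eisenstein-resource-bdp-line` (registry v27):
# THE FLIPPED-CUSP RUNG, piece T5 layer B/3 — (Rung⁶) ⟸ (JML⁶): THE RUNG IN COHEN-NUMBER CURRENCY FROM THE JOINT MODULAR LEMMA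
# (cell `bsd-print-cfram`, width seat `bsd-line-cfram-p1-w8` g9; THEOREMS ONLY, `--supports` 20372; BSD is not proved by any of this)

HONEST FRAMING. Nothing here is a statement about BSD; no registered stub is closed. With layer A (`flipRung_six_of_rung`, p707470)
registry v27's `stub_flipRung` follows from (Rung⁶) («`H(k, ·) ≡ 0 (mod p)` on the (3,0)-refined `τ`-cut ⟹ the same on the cut flipped
at `q`»). This file isolates what the MODULAR side of the typing (T1 w6 g9 finite Fourier lemma, T2 w2 g14 matrix factorisation, T3 w4 g19
slash at the flipped cusp `coeff_flippedCusp_eq`, T4 w3 g19 Katz transport, the vehicle (G)) has to deliver, as ONE statement with NO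
modular object in it — **(JML⁶), the joint modular lemma**: for a class datum, a `±1` pattern `τ`, an odd prime `q ∣ m` with `q* ≢ 1 (mod p)`,
a sign `σ`, and any coefficient function `a` equal to `H(k, ·)` on the AWAY-FROM-`q` cut and `0` off it, there are `N` (`p ∤ N`, `2 ∣ N`),
`D` (`q² ∣ D`, a period of the away cut), `Θ : PowerSeries ℕ` (`Θ(0) = 1`, supported on `Dℕ` — the theta factor `θ(q²Q₀²z)`) and a rational
`p`-unit `w` (`= q^(−2k−1)(1 − q*)/2` in T3's normalisation) such that: if `coeff n (a ⋆ Θ) ∈ p·ℤ̄[1/N]` at every `n` with `q ∥ n` in the Legendre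
class `σ` (the vehicle `V_σ = P_σ(F₀)` is `≡ 0 (mod p)` at `∞`), then `w · coeff n (a ⋆ Θ) ∈ p·ℤ̄[1/N]` at every `n` with `q ∥ n` in the class
`−σ` (Katz at the cusp `ω₀(∞)` + the slash computation + `S(qu) = (q/2)(1 − q*)` on the opposite class). And it PROVES
**`rung_six_of_jml : (JML⁶) → (Rung⁶)`**: input side = B/1 `fullCut_iff_awayCut_and_at` + B/2 deconvolution (⇐) over the subgroup
`{‖x‖_p ≤ p⁻¹} ⊓ {dyadic}` + Carlitz + the input reading; output side = the output reading + deconvolution (⇒) + B/1 again at the flipped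
pattern. So `stub_flipRung` ⟸ (JML⁶) by name (`flipRung_six_of_rung ∘ rung_six_of_jml`), and T3/T4/T1/(G) compose to (JML⁶) (B/4).

* §1 `classAt_add_iff` / `classAt_periodic` — the Legendre-class-at-`q` predicate `q ∥ n ∧ J(n/q | q) = s` is `D`-periodic for `q² ∣ D`;
  `exists_addSubgroup_dyadic` — `{x : ∃ j z, 2^j x = z}` as an `AddSubgroup ℚ`; `not_sq_dvd_conductor_of_odd_prime` — `q ∥ m` for the conductor
  of a primitive quadratic character and an odd prime `q ∣ m`; `sign_at_q` — `τ(q)·J(−1|q)·J(m/q|q) = ±1`.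
* §2 **`rung_six_of_jml`**.

No definitions, no named facts, no `sorry`. beyond-print theorem: NO (assembly). References: crux notes lead-g14 §2.1–§2.2; [Cohen1975] Thm. 3.1;
[Katz1973] Cor. 1.6.2 (currency only).
-/

set_option autoImplicit false
-- summit-side namespace `Summit.BirchSwinnertonDyer.BirchSwinnertonDyer.…` (single-conjunct summit, D-0017 layout)
set_option linter.dupNamespace false

noncomputable section

open scoped Classical NumberTheorySymbols
open PowerSeries DirichletCharacter
open Literature.NumberTheory.ModularForms.CohenEisenstein

namespace Summit.BirchSwinnertonDyer.BirchSwinnertonDyer.Theorems.PrintCFram.FlipRung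

open Summit.BirchSwinnertonDyer.BirchSwinnertonDyer.Theorems.PrintCFram

/-! ## §1 Small pieces -/

/-- The Legendre-class-at-`q` predicate is invariant under `n ↦ n + D·t` for `q² ∣ D`. [folklore] -/
theorem classAt_add_iff (q D n t : ℕ) (s : ℤ) (hq : 0 < q) (hD : q ^ 2 ∣ D) :
    (q ∣ n + D * t ∧ ¬ q ^ 2 ∣ n + D * t ∧ jacobiSym (((n + D * t) / q : ℕ) : ℤ) q = s) ↔
      (q ∣ n ∧ ¬ q ^ 2 ∣ n ∧ jacobiSym ((n / q : ℕ) : ℤ) q = s) := by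
  obtain ⟨E, rfl⟩ := hD
  have h1 : q ∣ n + q ^ 2 * E * t ↔ q ∣ n := Nat.dvd_add_left ⟨q * E * t, by ring⟩
  have h2 : q ^ 2 ∣ n + q ^ 2 * E * t ↔ q ^ 2 ∣ n := Nat.dvd_add_left ⟨E * t, by ring⟩
  rw [h1, h2]
  constructor
  · rintro ⟨hqn, hq2n, hJ⟩
    refine ⟨hqn, hq2n, ?_⟩
    obtain ⟨c, rfl⟩ := hqn
    rw [show q * c + q ^ 2 * E * t = q * (c + q * E * t) by ring, Nat.mul_div_cancel_left _ hq] at hJ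
    rw [Nat.mul_div_cancel_left _ hq, ← hJ, jacobiSym.mod_left ((c : ℕ) : ℤ), jacobiSym.mod_left (((c + q * E * t : ℕ)) : ℤ)]
    congr 1
    push_cast
    rw [show (c : ℤ) + (q : ℤ) * E * t = c + q * (E * t) by ring, Int.add_mul_emod_self_left]
  · rintro ⟨hqn, hq2n, hJ⟩
    refine ⟨hqn, hq2n, ?_⟩
    obtain ⟨c, rfl⟩ := hqn
    rw [Nat.mul_div_cancel_left _ hq] at hJ
    rw [show q * c + q ^ 2 * E * t = q * (c + q * E * t) by ring, Nat.mul_div_cancel_left _ hq, ← hJ,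
      jacobiSym.mod_left ((c : ℕ) : ℤ), jacobiSym.mod_left (((c + q * E * t : ℕ)) : ℤ)]
    congr 1
    push_cast
    rw [show (c : ℤ) + (q : ℤ) * E * t = c + q * (E * t) by ring, Int.add_mul_emod_self_left]

/-- The Legendre-class-at-`q` predicate is `D`-periodic for `q² ∣ D`. [folklore] -/
theorem classAt_periodic (q D : ℕ) (s : ℤ) (hq : 0 < q) (hD : q ^ 2 ∣ D) :
    Function.Periodic (fun n : ℕ => q ∣ n ∧ ¬ q ^ 2 ∣ n ∧ jacobiSym ((n / q : ℕ) : ℤ) q = s) D := by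
  intro n
  have h := classAt_add_iff q D n 1 s hq hD
  rw [mul_one] at h
  exact propext h

/-- **The dyadic rationals `{x : 2^j·x ∈ ℤ}` as an `AddSubgroup ℚ`.** [folklore] -/
theorem exists_addSubgroup_dyadic : ∃ S : AddSubgroup ℚ, ∀ x : ℚ, x ∈ S ↔ ∃ (j : ℕ) (z : ℤ), (2 : ℚ) ^ j * x = z := by
  refine ⟨{ carrier := {x : ℚ | ∃ (j : ℕ) (z : ℤ), (2 : ℚ) ^ j * x = z}
            add_mem' := ?_
            zero_mem' := ⟨0, 0, by simp⟩
            neg_mem' := ?_ }, fun x => Iff.rfl⟩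
  · rintro a b ⟨j₁, z₁, h₁⟩ ⟨j₂, z₂, h₂⟩
    refine ⟨j₁ + j₂, 2 ^ j₂ * z₁ + 2 ^ j₁ * z₂, ?_⟩
    push_cast
    rw [← h₁, ← h₂]; ring
  · rintro a ⟨j, z, h⟩
    exact ⟨j, -z, by push_cast; rw [← h]; ring⟩

/-- **`q ∥ m` for an odd prime `q` dividing the conductor `m` of a primitive quadratic character** (`e* = χ(−1)·m` is a fundamental
discriminant, whose odd part is squarefree). [cite: MontgomeryVaughan2007, Thm. 9.13] -/
theorem not_sq_dvd_conductor_of_odd_prime {p : ℕ} [Fact p.Prime] {m : ℕ} [NeZero m] {χ : DirichletCharacter ℚ_[p] m}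
    (hχ : χ.IsPrimitive) (hχq : χ.IsQuadratic) {q : ℕ} (hq : q.Prime) (hq2 : q ≠ 2) (hqm : q ∣ m) : ¬ q ^ 2 ∣ m := by
  obtain ⟨s, hs1', hs⟩ := Literature.NumberTheory.LFunctions.PrimitiveQuadratic.exists_sign_eq_of_charZero χ
  have hs1 : s = 1 ∨ s = -1 := by rcases hs1' with ⟨h, -⟩ | ⟨h, -⟩ <;> simp [h]
  have hsq_of : Squarefree (s * m : ℤ) → ¬ q ^ 2 ∣ m := by
    intro hsf hdvd
    have h1 : ((q : ℤ)) * q ∣ (s * m : ℤ) := by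
      obtain ⟨c, hc⟩ := hdvd
      exact ⟨s * c, by rw [hc]; push_cast; ring⟩
    have hu := hsf (q : ℤ) h1
    rw [Int.isUnit_iff_natAbs_eq, Int.natAbs_natCast] at hu
    exact hq.one_lt.ne' hu
  rintro hdvd
  rcases CohenCut.sign_mul_eq_one_or_isFundamental hχ hχq hs hs1 with h | ⟨-, hsf, -⟩ | ⟨h4, -, hsf⟩
  · -- `m = 1`
    have hm1 : m = 1 := by
      rcases hs1 with rfl | rfl
      · simpa using h
      · have : (m : ℤ) = -1 := by linarith
        exact absurd this (by omega)
    rw [hm1] at hqm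
    exact hq.one_lt.ne' (Nat.dvd_one.mp hqm)
  · exact hsq_of hsf hdvd
  · -- `e* = 4e'`, `e'` squarefree: an odd `q²` dividing `m` divides `e'`
    obtain ⟨c, hc⟩ := hdvd
    obtain ⟨e', he'⟩ := h4
    have hq2Z : ¬ (2 : ℤ) ∣ q := by
      intro h
      have : 2 ∣ q := by exact_mod_cast h
      exact hq2 ((Nat.prime_dvd_prime_iff_eq Nat.prime_two hq).mp this).symm
    -- `q² ∣ e'`
    have hdiv : (s * m : ℤ) / 4 = e' := by rw [he', Int.mul_ediv_cancel_left _ (by norm_num)]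
    rw [hdiv] at hsf
    have hqe : ((q : ℤ)) * q ∣ e' := by
      have h1 : ((q : ℤ)) ^ 2 ∣ 4 * e' := by rw [← he', hc]; push_cast; exact ⟨s * c, by ring⟩
      have hcop : IsCoprime ((q : ℤ) ^ 2) 4 := by
        have h2 : IsCoprime (q : ℤ) (2 : ℤ) := by
          have h := Nat.isCoprime_iff_coprime.mpr ((Nat.coprime_primes hq Nat.prime_two).mpr hq2)
          exact_mod_cast h
        have h4 : IsCoprime ((q : ℤ) ^ 2) ((2 : ℤ) ^ 2) := IsCoprime.pow h2
        norm_num at h4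
        exact h4
      rw [pow_two] at hcop h1
      exact hcop.dvd_of_dvd_mul_left h1
    have hu := hsf (q : ℤ) hqe
    rw [Int.isUnit_iff_natAbs_eq, Int.natAbs_natCast] at hu
    exact hq.one_lt.ne' hu

/-- **The sign at `q`: `τ(q)·J(−1 | q)·J(m_q | q) = ±1`** (`q ∤ m_q`). [folklore] -/
theorem sign_at_q_eq_one_or {q mq : ℕ} (hq : q.Prime) (hqmq : ¬ q ∣ mq) {t : ℤ} (ht : t = 1 ∨ t = -1) :
    t * jacobiSym (-1) q * jacobiSym ((mq : ℕ) : ℤ) q = 1 ∨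
      t * jacobiSym (-1) q * jacobiSym ((mq : ℕ) : ℤ) q = -1 := by
  haveI : NeZero q := ⟨hq.ne_zero⟩
  have h1 : jacobiSym (-1) q = 1 ∨ jacobiSym (-1) q = -1 :=
    jacobiSym.eq_one_or_neg_one (by rw [Int.gcd_comm]; simp)
  have h2 : jacobiSym ((mq : ℕ) : ℤ) q = 1 ∨ jacobiSym ((mq : ℕ) : ℤ) q = -1 :=
    jacobiSym.eq_one_or_neg_one (by
      rw [Int.gcd_natCast_natCast]
      exact Nat.coprime_comm.mp ((Nat.Prime.coprime_iff_not_dvd hq).mpr hqmq))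
  rcases ht with rfl | rfl <;> rcases h1 with h1 | h1 <;> rcases h2 with h2 | h2 <;> simp [h1, h2]

/-! ## §2 (Rung⁶) ⟸ (JML⁶) -/

/-- **THE RUNG IN COHEN-NUMBER CURRENCY FROM THE JOINT MODULAR LEMMA.** See the module docstring for (JML⁶) (the hypothesis `hJML`)
and layer A for (Rung⁶) (the conclusion, `hRung` of `flipRung_six_of_rung` VERBATIM). PROOF. Fix the datum, `τ`, `q`, the FULL-cut
hypothesis and a FULL index `a'` of the flipped cut. `q ∥ m` (`not_sq_dvd_conductor_of_odd_prime`); `σ := τ(q)·J(−1|q)·J(m_q|q)`;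
`a(i) := H(k, i)` on AWAY, `0` off it; take `N, D, Θ, w` from (JML⁶). INPUT: at `n` with `q ∥ n` of class `σ`, every term
`a(n − jD)·Θ(jD)` of `coeff n (a ⋆ Θ)` has `n − jD` of class `σ` (`q² ∣ D`) and AWAY or `a = 0`; AWAY ∧ class `σ` = FULL_τ
(`fullCut_iff_awayCut_and_at`), so `H(k, n − jD)` has `‖·‖_p ≤ p⁻¹` (hypothesis) and `2^j·H ∈ ℤ` (Carlitz); deconvolution (⇐) over
`{‖·‖_p ≤ p⁻¹} ⊓ {dyadic}` and the input reading give `coeff n (a ⋆ Θ) ∈ p·ℤ̄[1/N]`. OUTPUT: (JML⁶) gives `w·coeff n (a ⋆ Θ) ∈ p·ℤ̄[1/N]` on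
class `−σ`, the output reading `‖coeff n (a ⋆ Θ)‖_p ≤ p⁻¹`, deconvolution (⇒) `‖a(n)‖_p ≤ p⁻¹` on class `−σ`; the target index is AWAY
(same away pattern) of class `−σ`, where `a = H(k, ·)`. [cite: Cohen1975, Thm. 3.1] [cite: Katz1973, §1.6 Cor. 1.6.2] -/
theorem rung_six_of_jml
    (hJML : ∀ (p : ℕ) [Fact p.Prime] (m : ℕ) [NeZero m] (χ : DirichletCharacter ℚ_[p] m) (k : ℕ),
      (p = 7 ∨ p = 11 ∨ p = 19 ∨ p = 43 ∨ p = 67 ∨ p = 163) →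
      m.Coprime p → χ.IsPrimitive → χ.IsQuadratic → (k = (p + 1) / 4 ∨ k = (3 * p - 1) / 4) →
      2 ≤ k → k ≤ p - 2 → χ (-1) * (-1) ^ k = -1 →
      ∀ (τ : ℕ → ℤ) (q : ℕ), q.Prime → q ∣ m → q ≠ 2 →
      (∀ q' : ℕ, q'.Prime → q' ∣ m → q' ≠ 2 → (τ q' = 1 ∨ τ q' = -1)) →
      ¬ ((p : ℤ) ∣ (q : ℤ) * jacobiSym (-1) q - 1) →
      ∀ (σ : ℤ), (σ = 1 ∨ σ = -1) →
      ∀ (a : ℕ → ℚ),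
        (∀ i : ℕ, (m / q ∣ i ∧ i / (m / q) % 4 = 3 * q % 4 ∧
            (∀ q' : ℕ, q'.Prime → q' ∣ m / q → q' ≠ 2 →
              jacobiSym (-((i / (m / q) : ℕ) : ℤ)) q' = τ q' * jacobiSym (q : ℤ) q') ∧
            (2 ∣ m → i / (m / q) % 8 = 7 * q % 8) ∧ (q ≠ 3 → ¬ 3 ∣ i / (m / q))) → a i = cohenH k i) →
        (∀ i : ℕ, ¬ (m / q ∣ i ∧ i / (m / q) % 4 = 3 * q % 4 ∧
            (∀ q' : ℕ, q'.Prime → q' ∣ m / q → q' ≠ 2 →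
              jacobiSym (-((i / (m / q) : ℕ) : ℤ)) q' = τ q' * jacobiSym (q : ℤ) q') ∧
            (2 ∣ m → i / (m / q) % 8 = 7 * q % 8) ∧ (q ≠ 3 → ¬ 3 ∣ i / (m / q))) → a i = 0) →
      ∃ (N D : ℕ) (Θ : PowerSeries ℕ) (w : ℚ),
        ¬ p ∣ N ∧ 2 ∣ N ∧ q ^ 2 ∣ D ∧
        Function.Periodic (fun i : ℕ => (m / q ∣ i ∧ i / (m / q) % 4 = 3 * q % 4 ∧
            (∀ q' : ℕ, q'.Prime → q' ∣ m / q → q' ≠ 2 →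
              jacobiSym (-((i / (m / q) : ℕ) : ℤ)) q' = τ q' * jacobiSym (q : ℤ) q') ∧
            (2 ∣ m → i / (m / q) % 8 = 7 * q % 8) ∧ (q ≠ 3 → ¬ 3 ∣ i / (m / q)))) D ∧
        PowerSeries.coeff 0 Θ = 1 ∧ (∀ j : ℕ, PowerSeries.coeff j Θ ≠ 0 → D ∣ j) ∧ w ≠ 0 ∧ padicValRat p w = 0 ∧
        ((∀ n : ℕ, q ∣ n → ¬ q ^ 2 ∣ n → jacobiSym ((n / q : ℕ) : ℤ) q = σ →
            ∃ y : ℂ, (∃ j : ℕ, IsIntegral ℤ ((N : ℂ) ^ j * y)) ∧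
              ((PowerSeries.coeff n (PowerSeries.mk a * PowerSeries.map (Nat.castRingHom ℚ) Θ) : ℚ) : ℂ) = (p : ℂ) * y) →
          ∀ n : ℕ, q ∣ n → ¬ q ^ 2 ∣ n → jacobiSym ((n / q : ℕ) : ℤ) q = -σ →
            ∃ y : ℂ, (∃ j : ℕ, IsIntegral ℤ ((N : ℂ) ^ j * y)) ∧
              ((PowerSeries.coeff n (PowerSeries.mk a * PowerSeries.map (Nat.castRingHom ℚ) Θ) * w : ℚ) : ℂ) = (p : ℂ) * y)) :
    ∀ (p : ℕ) [Fact p.Prime] (m : ℕ) [NeZero m] (χ : DirichletCharacter ℚ_[p] m) (k : ℕ),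
      (p = 7 ∨ p = 11 ∨ p = 19 ∨ p = 43 ∨ p = 67 ∨ p = 163) →
      m.Coprime p → χ.IsPrimitive → χ.IsQuadratic → (k = (p + 1) / 4 ∨ k = (3 * p - 1) / 4) →
      2 ≤ k → k ≤ p - 2 → χ (-1) * (-1) ^ k = -1 →
      ∀ (τ : ℕ → ℤ) (q : ℕ), q.Prime → q ∣ m → q ≠ 2 →
      (∀ q' : ℕ, q'.Prime → q' ∣ m → q' ≠ 2 → (τ q' = 1 ∨ τ q' = -1)) →
      ¬ ((p : ℤ) ∣ (q : ℤ) * jacobiSym (-1) q - 1) →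
      (∀ a : ℕ, m ∣ a → a / m % 4 = 3 →
        (∀ q' : ℕ, q'.Prime → q' ∣ m → q' ≠ 2 → jacobiSym (-((a / m : ℕ) : ℤ)) q' = τ q') →
        (2 ∣ m → a / m % 8 = 7) → ¬ 3 ∣ a / m → ‖((cohenH k a : ℚ) : ℚ_[p])‖ ≤ (p : ℝ)⁻¹) →
      ∀ a : ℕ, m ∣ a → a / m % 4 = 3 →
        (∀ q' : ℕ, q'.Prime → q' ∣ m → q' ≠ 2 → jacobiSym (-((a / m : ℕ) : ℤ)) q' = (if q' = q then -τ q' else τ q')) →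
        (2 ∣ m → a / m % 8 = 7) → ¬ 3 ∣ a / m → ‖((cohenH k a : ℚ) : ℚ_[p])‖ ≤ (p : ℝ)⁻¹ := by
  intro p _ m _ χ k hp6 hmp hχ hχq hk hk2 hkp hpar τ q hq hqm hq2 hτ hstar hcut a' hma' ha4' hJ' h8' h3'
  have hpp : p.Prime := Fact.out
  have hq0 : 0 < q := hq.pos
  have hm0 : 0 < m := Nat.pos_of_ne_zero (NeZero.ne m)
  have hk1 : 1 ≤ k := by omega
  have hm1 : m ≠ 1 := by
    rintro rfl
    exact hq.one_lt.ne' (Nat.dvd_one.mp hqm)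
  -- `q ∥ m`, `m_q := m / q`, `q ∤ m_q`
  have hqm2 : ¬ q ^ 2 ∣ m := not_sq_dvd_conductor_of_odd_prime hχ hχq hq hq2 hqm
  obtain ⟨mq, hm⟩ := hqm
  have hmq : m / q = mq := by rw [hm, Nat.mul_div_cancel_left _ hq0]
  have hqmq : ¬ q ∣ mq := by
    rintro ⟨c, rfl⟩
    exact hqm2 ⟨c, by rw [hm]; ring⟩
  -- the flipped pattern and the two signs at `q`
  set τ' : ℕ → ℤ := fun x => if x = q then -τ x else τ x with hτ'def
  have hτ' : ∀ q' : ℕ, q'.Prime → q' ∣ m → q' ≠ 2 → (τ' q' = 1 ∨ τ' q' = -1) := by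
    intro q' hq' hq'm hq'2
    rcases hτ q' hq' hq'm hq'2 with h | h
    · by_cases hqq : q' = q
      · subst hqq; simp [hτ'def, h]
      · simp [hτ'def, hqq, h]
    · by_cases hqq : q' = q
      · subst hqq; simp [hτ'def, h]
      · simp [hτ'def, hqq, h]
  have hτq : τ q = 1 ∨ τ q = -1 := hτ q hq ⟨mq, hm⟩ hq2
  set σ : ℤ := τ q * jacobiSym (-1) q * jacobiSym ((m / q : ℕ) : ℤ) q with hσdef
  have hσ : σ = 1 ∨ σ = -1 := by rw [hσdef, hmq]; exact sign_at_q_eq_one_or hq hqmq hτq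
  have hσ' : τ' q * jacobiSym (-1) q * jacobiSym ((m / q : ℕ) : ℤ) q = -σ := by
    have hτ'q : τ' q = -τ q := by simp [hτ'def]
    rw [hτ'q, hσdef]; ring
  -- the coefficient function of the away-cut
  set a : ℕ → ℚ := fun i =>
    if (m / q ∣ i ∧ i / (m / q) % 4 = 3 * q % 4 ∧
            (∀ q' : ℕ, q'.Prime → q' ∣ m / q → q' ≠ 2 →
              jacobiSym (-((i / (m / q) : ℕ) : ℤ)) q' = τ q' * jacobiSym (q : ℤ) q') ∧
            (2 ∣ m → i / (m / q) % 8 = 7 * q % 8) ∧ (q ≠ 3 → ¬ 3 ∣ i / (m / q)))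
    then cohenH k i else 0 with hadef
  obtain ⟨N, D, Θ, w, hpN, h2N, hqD, hperA, hΘ0, hΘ, hw0, hw, himp⟩ :=
    hJML p m χ k hp6 hmp hχ hχq hk hk2 hkp hpar τ q hq ⟨mq, hm⟩ hq2 hτ hstar σ hσ a
      (fun i hi => by rw [hadef]; exact if_pos hi) (fun i hi => by rw [hadef]; exact if_neg hi)
  -- the two subgroups
  obtain ⟨Sp, hSp⟩ := exists_addSubgroup_padicNorm_le p
  obtain ⟨S2, hS2⟩ := exists_addSubgroup_dyadic
  have hperσ := classAt_periodic q D σ hq0 hqD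
  have hperσ' := classAt_periodic q D (-σ) hq0 hqD
  -- INPUT: the coefficients of `a` on class `σ` lie in `Sp ⊓ S2`
  have hin : ∀ n : ℕ, (q ∣ n ∧ ¬ q ^ 2 ∣ n ∧ jacobiSym ((n / q : ℕ) : ℤ) q = σ) →
      PowerSeries.coeff n (PowerSeries.mk a) ∈ Sp ⊓ S2 := by
    rintro n ⟨hqn, hq2n, hcls⟩
    rw [PowerSeries.coeff_mk, AddSubgroup.mem_inf, hSp, hS2]
    by_cases hA : (m / q ∣ n ∧ n / (m / q) % 4 = 3 * q % 4 ∧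
            (∀ q' : ℕ, q'.Prime → q' ∣ m / q → q' ≠ 2 →
              jacobiSym (-((n / (m / q) : ℕ) : ℤ)) q' = τ q' * jacobiSym (q : ℤ) q') ∧
            (2 ∣ m → n / (m / q) % 8 = 7 * q % 8) ∧ (q ≠ 3 → ¬ 3 ∣ n / (m / q)))
    · have ha : a n = cohenH k n := by rw [hadef]; exact if_pos hA
      -- AWAY ∧ class σ = FULL_τ
      obtain ⟨hmn, hn4, hJn, hn8, hn3⟩ :=
        (fullCut_iff_awayCut_and_at hq hq2 ⟨mq, hm⟩ hqm2 hτ n).mpr ⟨hA, hqn, hq2n, hcls⟩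
      rw [ha]
      exact ⟨hcut n hmn hn4 hJn hn8 hn3,
        exists_two_pow_mul_cohenH_eq_intCast_of_cut_sign hm1 hχ hχq hk1 hpar hτ hmn hn4 hJn⟩
    · have ha : a n = 0 := by rw [hadef]; exact if_neg hA
      rw [ha]
      exact ⟨by simp, ⟨0, 0, by simp⟩⟩
  have hin' := forall_coeff_mul_mem_of_periodic (Sp ⊓ S2) (PowerSeries.mk a) Θ hΘ0 hΘ hperσ hin
  -- INPUT in NF-Q currency
  have hinQ : ∀ n : ℕ, q ∣ n → ¬ q ^ 2 ∣ n → jacobiSym ((n / q : ℕ) : ℤ) q = σ →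
      ∃ y : ℂ, (∃ j : ℕ, IsIntegral ℤ ((N : ℂ) ^ j * y)) ∧
        ((PowerSeries.coeff n (PowerSeries.mk a * PowerSeries.map (Nat.castRingHom ℚ) Θ) : ℚ) : ℂ) = (p : ℂ) * y := by
    intro n hqn hq2n hcls
    have hmem := hin' n ⟨hqn, hq2n, hcls⟩
    rw [AddSubgroup.mem_inf, hSp, hS2] at hmem
    exact exists_eq_prime_mul_isIntegral_of_padicNorm_le h2N hmem.1 hmem.2
  -- OUTPUT on class `−σ`
  have hout := himp hinQ
  have hout' : ∀ n : ℕ, (q ∣ n ∧ ¬ q ^ 2 ∣ n ∧ jacobiSym ((n / q : ℕ) : ℤ) q = -σ) →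
      PowerSeries.coeff n (PowerSeries.mk a * PowerSeries.map (Nat.castRingHom ℚ) Θ) ∈ Sp := by
    rintro n ⟨hqn, hq2n, hcls⟩
    obtain ⟨y, hy, hxy⟩ := hout n hqn hq2n hcls
    rw [hSp]
    exact padicNorm_le_inv_of_mul_unit_eq_prime_mul hpN hw0 hw hy hxy
  have houtA := forall_coeff_mem_of_mul_mem_of_periodic Sp (PowerSeries.mk a) Θ hΘ0 hΘ hperσ' hout'
  -- the target index `a'` is AWAY (flipped pattern agrees away from `q`) of class `−σ`
  obtain ⟨hA', hqa', hq2a', hcls'⟩ := (fullCut_iff_awayCut_and_at hq hq2 ⟨mq, hm⟩ hqm2 hτ' a').mp ⟨hma', ha4', hJ', h8', h3'⟩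
  rw [hσ'] at hcls'
  have hA : (m / q ∣ a' ∧ a' / (m / q) % 4 = 3 * q % 4 ∧
            (∀ q' : ℕ, q'.Prime → q' ∣ m / q → q' ≠ 2 →
              jacobiSym (-((a' / (m / q) : ℕ) : ℤ)) q' = τ q' * jacobiSym (q : ℤ) q') ∧
            (2 ∣ m → a' / (m / q) % 8 = 7 * q % 8) ∧ (q ≠ 3 → ¬ 3 ∣ a' / (m / q))) := by
    obtain ⟨h1, h2, h3, h4, h5⟩ := hA'
    refine ⟨h1, h2, fun q' hq' hq'm hq'2 => ?_, h4, h5⟩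
    have hqq : q' ≠ q := by
      rintro rfl
      rw [hmq] at hq'm
      exact hqmq hq'm
    have := h3 q' hq' hq'm hq'2
    rw [hτ'def] at this
    simpa [hqq] using this
  have hmem := houtA a' ⟨hqa', hq2a', hcls'⟩
  rw [PowerSeries.coeff_mk, hSp] at hmem
  have ha : a a' = cohenH k a' := by rw [hadef]; exact if_pos hA
  rw [ha] at hmem
  exact hmem

end Summit.BirchSwinnertonDyer.BirchSwinnertonDyer.Theorems.PrintCFram.FlipRung

end
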